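import Summits.QuantumFields.BalabanUV.T4Continuum.Spine.NE2BalabanStationsRate
import Summits.QuantumFields.BalabanUV.T4Continuum.Spine.NE2BalabanDecayRate

/-!
# T⁴ programme, spine node NE2 (U1a), row B8 × sub-row Δ3 «NE2-WALK» — ROOT B's DECAY STATIONS AT A GENERAL GEOMETRIC RATE `θ`:
# King's (4.38) shape for `pertCovC` / `pertLimC` of Bałaban's typed tier-B operator when node NE3 supplies its `LocalRate` at any
# `θ ∈ [L⁻¹, 1)` — the rate-`θ` twin of `NE2BalabanDecayRate.balaban_final_decayStations_of_regular`

Twelfth generation of the NE2 prover lineage P1 of the cell `pub-balaban` (row NE2 owner), file 1 (owner item O12-a; the corollary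
offered by leaf-08-g2 with row B8 part 6, journal 2026-08-20 l.14254, taken by the owner in ruling R21).  Row B8 re-typed ROOT B at a
general geometric rate (`NE2BalabanFinalRate.balaban_final_rate_of_regular_rate`, `NE2BalabanStationsRate.balaban_final_stations_of_regular_rate`:
node NE3's `LocalRate … C θ` with `L⁻¹ ≤ θ < 1` in place of `θ = L⁻¹`); sub-row Δ3 converted the operator-norm rate into King's entrywise
shape with exponential off-diagonal decay modulo ONE displayed level-uniform decay binder `hdec` (`DecayRateInterpolation.decayStations_of_rate`).
This file composes the two BY NAME:

 * **`balaban_final_decayStations_of_regular_rate`** — displayed binders: those of `balaban_final_stations_of_regular_rate` (`hreg`, `hC`,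
   `hθ : L⁻¹ ≤ θ`, `hθ1 : θ < 1`, `hNE3θ`, `0 < a′`, `α ≤ η`, `β ≤ η`, `η ≤ etaStar o d a a′`, `‖t‖ ≤ 1`) PLUS `hdec` ⟹ the named limit
   `pertLimC P_B t` has entry decay `(B, δ)`, `‖(pertCovC P_B t k − pertLimC P_B t)(x,y)‖ ≤ √(2B·C_B(t)/(1−θ))·(√θ)^k·e^{−(δ/2)dist(x,y)}` and
   `‖(pertCovC P_B t (k+1) − pertCovC P_B t k)(x,y)‖ ≤ √(2B·2C_B(t)/(1−θ))·(√θ)^k·e^{−(δ/2)dist(x,y)}`;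
 * **`balaban_final_twoLevelDecayRate_one_rate`** — the physical coupling `t = 1`, two-level form (`∃ B₀, … ≤ B₀·(√θ)^k·e^{−(δ/2)dist}`);
 * a kernel `example`: at `θ = L⁻¹` (`L ≥ 2`) the conclusion has EXACTLY the type of `NE2BalabanDecayRate.balaban_final_decayStations_of_regular`
   (the instance of record is the case `θ = L⁻¹`; stated as an `example`, a named corollary would restate the record).

WHY (located, row B8's reason): node NE3's supply in the sup currency through the (3.35)-shape Lipschitz input gives a geometric rate
`θ` of `L^{−2/3}`-type at `d = 4` (GAPS G-ne2leaf08g2-1), slower than `L⁻¹`; every consumer of the decay stations (node U3, NE5's O1-b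
junction `Support/OutputRateDecayBalaban`) is indifferent to which geometric rate it is handed, and this file makes ROOT B's decay stations
available at whatever rate NE3 lands.

WHAT `hdec` IS (honest, as in `Spine/NE2BalabanDecayRate`).  `∀ k, EntryDecay dist (pertCovC P_B t k) B δ`: the level-UNIFORM exponential
decay of the King-averaged unit-lattice covariances — the KIND of bound the audited series prints η-uniformly ([Balaban1984PropagatorsI]
(1.90) p. 33; [Balaban1985BackgroundPropagators] Thm 3.4 p. 400; King (4.34) p. 674).  DISPLAYED, asserted by nobody for the tier-B data
`P_B` (dictionary B0); at `U = 1` (`P = 0`, `t = 0`, `a = 1`) it is a THEOREM (`FreeTowerEntryDecay.entryDecay_pertCovC_zero`, leaf-05-g5).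

HONEST FRAMING (T4-DAG p. 1).  Model level (no B0); finite torus, linear layer; statements and constants OURS ([folklore] bookkeeping over
landed modules — nothing printed is a hypothesis, `[cite:]` tags locate SHAPES); CONDITIONAL on node NE3's `LocalRate … C θ` BY NAME (OPEN),
on the (3.35)-shape class, on the explicit threshold AND on `hdec`; NOT [B9] (3.23)–(3.27) as printed; NE2 (U1a) is NOT proved by this
file; spine PROVED 0/9 unchanged; NOT infinite volume, NOT a mass gap, NOT the Clay problem, NOT summit progress.  HONEST DEPENDENCY:
continuum YM on T⁴ ⇐ BetaPertH ∧ nine spine estimates (0/9 proved); BetaPertH ⇐ (D1) ∧ (D4) ∧ CAP+tail; G-an2-4 gates asym, D1 and NE2/3/4.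
No `sorry`.
-/

noncomputable section

open scoped BigOperators ComplexConjugate Matrix Matrix.Norms.L2Operator Kronecker
open Filter Topology

namespace Summit.QuantumFields.BalabanUV.T4Continuum.NE2BalabanDecayRateTheta

open Literature.MathematicalPhysics.QuantumFieldTheory.Balaban1983to89.B5Prop11Plancherel (Cst Cst_nonneg Tor fine)
open Literature.MathematicalPhysics.QuantumFieldTheory.Balaban1983to89.B5G183RateUnitTower (lev lev_neZero)
open Literature.MathematicalPhysics.QuantumFieldTheory.Balaban1983to89.T4EtaRateMin (LocalRate)
open Summit.QuantumFields.BalabanUV.T4Continuum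
open Summit.QuantumFields.BalabanUV.T4Continuum.CovariantAveragingTower (avgTow TowerLimitRate)
open Summit.QuantumFields.BalabanUV.T4Continuum.BalabanAveragedTowerUnit (idx Qlev)
open Summit.QuantumFields.BalabanUV.T4Continuum.BackgroundResolventTower
open Summit.QuantumFields.BalabanUV.T4Continuum.KingPairingPlantedLaw
open Summit.QuantumFields.BalabanUV.T4Continuum.GramPerturbationLaw (C2gram)
open Summit.QuantumFields.BalabanUV.T4Continuum.NE2FromNE3 (bgReadings)
open Summit.QuantumFields.BalabanUV.T4Continuum.NE2ColourPerturbedLayer (pertCovC pertLimC)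
open Summit.QuantumFields.BalabanUV.T4Continuum.RegularBackgroundTower (RegularTransporters regClass betaNE3)
open Summit.QuantumFields.BalabanUV.T4Continuum.GaugeTermScalarData (QuT Q1)
open Summit.QuantumFields.BalabanUV.T4Continuum.RegularSiteTransporters (siteT)
open Summit.QuantumFields.BalabanUV.T4Continuum.NestedContourTransport (theta0)
open Summit.QuantumFields.BalabanUV.T4Continuum.NE2BalabanRoot (balabanPert)
open Summit.QuantumFields.BalabanUV.T4Continuum.NE2BalabanGauge (gaugeSlot liftR)
open Summit.QuantumFields.BalabanUV.T4Continuum.NE2BalabanLayerSharp (kappaBs C2Bs)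
open Summit.QuantumFields.BalabanUV.T4Continuum.NE2BalabanWiring (epsR CdeltaR)
open Summit.QuantumFields.BalabanUV.T4Continuum.NE2BalabanFinal (kappa4F C4F)
open Summit.QuantumFields.BalabanUV.T4Continuum.NE2BalabanThreshold (etaStar)
open Summit.QuantumFields.BalabanUV.T4Continuum.NE2BalabanStationsRate (balaban_final_stations_of_regular_rate)
open Summit.QuantumFields.BalabanUV.T4Continuum.NE2BalabanDecayRate (invL_nonneg invL_lt_one)
open Summit.QuantumFields.BalabanUV.T4Continuum.DecayRateInterpolation (EntryDecay DecayRate TwoLevelDecayRate decayStations_of_rate)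

variable {d : ℕ} (L : ℕ) [NeZero L] (M : Fin d → ℕ) [hM : ∀ μ, NeZero (M μ)] (a : ℝ) (ha : 0 < a)
variable {o : Type*} [Fintype o] [DecidableEq o]

/-- **ROOT B IN THE DECAY CURRENCY AT A GENERAL GEOMETRIC RATE `θ`** (`d ≥ 1`, `L⁻¹ ≤ θ < 1`, `a′ > 0`): for site-based bond
transporters `Rg` in row B5's (3.35)-shape class with sizes `α, β ≤ η ≤ η⋆(card o, d, a, a′)`, coefficient towers obeying NODE NE3's
`LocalRate … C θ` (BY NAME, OPEN), a coupling `‖t‖ ≤ 1`, and a level-UNIFORM entry decay `hdec : ∀ k x y, ‖(pertCovC P_B t k)(x,y)‖ ≤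
B·e^{−δ·dist(x,y)}` of the lifted King-averaged unit-lattice covariances of Bałaban's typed operator `Δ_a^{(k)}⊗1 + t·P_B`,
`P_B = balabanPert (liftR Rg) (gaugeSlot Rg (QuT (siteT Rg)) Q1 a′)`: the named η → 0 limit `pertLimC P_B t` has entry decay `(B, δ)`;
`‖(pertCovC P_B t k − pertLimC P_B t)(x,y)‖ ≤ √(2B·C_B(t)/(1−θ))·(√θ)^k·e^{−(δ/2)dist(x,y)}`; and
`‖(pertCovC P_B t (k+1) − pertCovC P_B t k)(x,y)‖ ≤ √(2B·2C_B(t)/(1−θ))·(√θ)^k·e^{−(δ/2)dist(x,y)}` — KING's (4.38) SHAPE for ROOT B at the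
rate NE3 supplies, the display of `T4EtaRate.EtaRateIneqUnit` with `(B₀, δ₀, θ) = (·, δ/2, √θ)`.  Displayed binders: those of
`NE2BalabanStationsRate.balaban_final_stations_of_regular_rate`, `‖t‖ ≤ 1`, `hdec` — NOTHING ELSE.  Model level (no B0); CONDITIONAL on NE3
+ the (3.35)-class + the threshold + `hdec`; NE2 (U1a) is NOT proved by this.  `NE2BalabanDecayRate.balaban_final_decayStations_of_regular`
is the case `θ = L⁻¹`.
[cite: King1986, Lemma 4.5 (4.38) p.674 (shape); Balaban1985BackgroundPropagators, (3.26) p.395, (3.35) p.396, Thm 3.4 p.400 (shapes)] [folklore] -/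
theorem balaban_final_decayStations_of_regular_rate (hd : 1 ≤ d)
    {Rg : (k : ℕ) → Fin d → (Tor (fine (lev L k) M) → Matrix o o ℂ)}
    {α β : ℝ} (hreg : RegularTransporters L M (liftR L M Rg) α β) {C θ : ℝ} (hC : 0 ≤ C) (hθ : ((L : ℝ)⁻¹) ≤ θ) (hθ1 : θ < 1)
    (hNE3θ : LocalRate (bgReadings L M (regClass L M (liftR L M Rg))) C θ) {a' : ℝ} (ha' : 0 < a')
    {η : ℝ} (hαη : α ≤ η) (hβη : β ≤ η) (hη : η ≤ etaStar o d a a') {t : ℂ} (ht : ‖t‖ ≤ 1)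
    {dist : idx L M 0 × o → idx L M 0 × o → ℝ} {B δ : ℝ}
    (hdec : ∀ k, EntryDecay dist
      (pertCovC L M a ha (balabanPert L M a (liftR L M Rg) (gaugeSlot L M Rg (QuT L M o (siteT L M Rg)) (Q1 L M o) a')) t k) B δ) :
    EntryDecay dist (pertLimC L M a ha (balabanPert L M a (liftR L M Rg) (gaugeSlot L M Rg (QuT L M o (siteT L M Rg)) (Q1 L M o) a')) t) B δ ∧
      DecayRate dist
        (pertCovC L M a ha (balabanPert L M a (liftR L M Rg) (gaugeSlot L M Rg (QuT L M o (siteT L M Rg)) (Q1 L M o) a')) t)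
        (pertLimC L M a ha (balabanPert L M a (liftR L M Rg) (gaugeSlot L M Rg (QuT L M o (siteT L M Rg)) (Q1 L M o) a')) t)
        (Real.sqrt (2 * B *
          (Cpert (kappaBs o d a α β (a * (epsR o d α * (2 + epsR o d α) * Cst d a)) (kappa4F d a a' α β)) (2 * d * Cst d a) (CJ d a)
              (C2Bs o d L a α β C
                (a * C2gram (Cst d a) 1 (epsR o d α) (2 * d * Cst d a) (CJ d a) (Cst d a) (CdeltaR o d a α (theta0 d α (betaNE3 o C))))
                (C4F o d L a a' α β C)) 0 t / (1 - θ))))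
        (δ / 2) (Real.sqrt θ) ∧
      TwoLevelDecayRate dist
        (pertCovC L M a ha (balabanPert L M a (liftR L M Rg) (gaugeSlot L M Rg (QuT L M o (siteT L M Rg)) (Q1 L M o) a')) t)
        (Real.sqrt (2 * B * (2 *
          Cpert (kappaBs o d a α β (a * (epsR o d α * (2 + epsR o d α) * Cst d a)) (kappa4F d a a' α β)) (2 * d * Cst d a) (CJ d a)
              (C2Bs o d L a α β C
                (a * C2gram (Cst d a) 1 (epsR o d α) (2 * d * Cst d a) (CJ d a) (Cst d a) (CdeltaR o d a α (theta0 d α (betaNE3 o C))))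
                (C4F o d L a a' α β C)) 0 t / (1 - θ))))
        (δ / 2) (Real.sqrt θ) := by
  obtain ⟨hlim, -, hrate, -, -⟩ :=
    balaban_final_stations_of_regular_rate L M a ha hd hreg hC hθ hθ1 hNE3θ ha' hαη hβη hη ht
  exact decayStations_of_rate ((invL_nonneg L).trans hθ) hθ1 hlim hrate hdec

/-- **ROOT B IN THE DECAY CURRENCY AT THE PHYSICAL COUPLING `t = 1`, RATE `θ`, two-level form** — the literal King (4.38) /
`EtaRateIneqUnit` display `‖(c_{k+1} − c_k)(x,y)‖ ≤ B₀·(√θ)^k·e^{−δ₀·dist(x,y)}` with `δ₀ = δ/2`, from the binders of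
`balaban_final_stations_of_regular_rate` + `hdec`.  Model level; CONDITIONAL on NE3 (`LocalRate … C θ`) + the (3.35)-class + the threshold +
`hdec`; NE2 (U1a) NOT proved by this. [cite: King1986, Lemma 4.5 (4.38) p.674 (shape)] [folklore] -/
theorem balaban_final_twoLevelDecayRate_one_rate (hd : 1 ≤ d)
    {Rg : (k : ℕ) → Fin d → (Tor (fine (lev L k) M) → Matrix o o ℂ)}
    {α β : ℝ} (hreg : RegularTransporters L M (liftR L M Rg) α β) {C θ : ℝ} (hC : 0 ≤ C) (hθ : ((L : ℝ)⁻¹) ≤ θ) (hθ1 : θ < 1)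
    (hNE3θ : LocalRate (bgReadings L M (regClass L M (liftR L M Rg))) C θ) {a' : ℝ} (ha' : 0 < a')
    {η : ℝ} (hαη : α ≤ η) (hβη : β ≤ η) (hη : η ≤ etaStar o d a a')
    {dist : idx L M 0 × o → idx L M 0 × o → ℝ} {B δ : ℝ}
    (hdec : ∀ k, EntryDecay dist
      (pertCovC L M a ha (balabanPert L M a (liftR L M Rg) (gaugeSlot L M Rg (QuT L M o (siteT L M Rg)) (Q1 L M o) a')) 1 k) B δ) :
    ∃ B₀ : ℝ, ∀ k (x y : idx L M 0 × o),
      ‖(pertCovC L M a ha (balabanPert L M a (liftR L M Rg) (gaugeSlot L M Rg (QuT L M o (siteT L M Rg)) (Q1 L M o) a')) 1 (k + 1)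
          - pertCovC L M a ha (balabanPert L M a (liftR L M Rg) (gaugeSlot L M Rg (QuT L M o (siteT L M Rg)) (Q1 L M o) a')) 1 k) x y‖
        ≤ B₀ * Real.sqrt θ ^ k * Real.exp (-(δ / 2 * dist x y)) := by
  have h1 : ‖(1 : ℂ)‖ ≤ 1 := by rw [norm_one]
  obtain ⟨-, -, h⟩ := balaban_final_decayStations_of_regular_rate L M a ha hd hreg hC hθ hθ1 hNE3θ ha' hαη hβη hη h1 hdec
  exact ⟨_, h⟩

/-- **CONSISTENCY WITH THE INSTANCE OF RECORD (kernel)**: at `θ = L⁻¹` (`L ≥ 2`) the rate-`θ` decay stations have EXACTLY the type of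
`NE2BalabanDecayRate.balaban_final_decayStations_of_regular`. -/
example (hL : 2 ≤ L) (hd : 1 ≤ d)
    {Rg : (k : ℕ) → Fin d → (Tor (fine (lev L k) M) → Matrix o o ℂ)}
    {α β : ℝ} (hreg : RegularTransporters L M (liftR L M Rg) α β) {C : ℝ} (hC : 0 ≤ C)
    (hNE3 : LocalRate (bgReadings L M (regClass L M (liftR L M Rg))) C ((L : ℝ)⁻¹)) {a' : ℝ} (ha' : 0 < a')
    {η : ℝ} (hαη : α ≤ η) (hβη : β ≤ η) (hη : η ≤ etaStar o d a a') {t : ℂ} (ht : ‖t‖ ≤ 1)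
    {dist : idx L M 0 × o → idx L M 0 × o → ℝ} {B δ : ℝ}
    (hdec : ∀ k, EntryDecay dist
      (pertCovC L M a ha (balabanPert L M a (liftR L M Rg) (gaugeSlot L M Rg (QuT L M o (siteT L M Rg)) (Q1 L M o) a')) t k) B δ) :
    EntryDecay dist (pertLimC L M a ha (balabanPert L M a (liftR L M Rg) (gaugeSlot L M Rg (QuT L M o (siteT L M Rg)) (Q1 L M o) a')) t) B δ ∧
      DecayRate dist
        (pertCovC L M a ha (balabanPert L M a (liftR L M Rg) (gaugeSlot L M Rg (QuT L M o (siteT L M Rg)) (Q1 L M o) a')) t)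
        (pertLimC L M a ha (balabanPert L M a (liftR L M Rg) (gaugeSlot L M Rg (QuT L M o (siteT L M Rg)) (Q1 L M o) a')) t)
        (Real.sqrt (2 * B *
          (Cpert (kappaBs o d a α β (a * (epsR o d α * (2 + epsR o d α) * Cst d a)) (kappa4F d a a' α β)) (2 * d * Cst d a) (CJ d a)
              (C2Bs o d L a α β C
                (a * C2gram (Cst d a) 1 (epsR o d α) (2 * d * Cst d a) (CJ d a) (Cst d a) (CdeltaR o d a α (theta0 d α (betaNE3 o C))))
                (C4F o d L a a' α β C)) 0 t / (1 - (L : ℝ)⁻¹))))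
        (δ / 2) (Real.sqrt ((L : ℝ)⁻¹)) ∧
      TwoLevelDecayRate dist
        (pertCovC L M a ha (balabanPert L M a (liftR L M Rg) (gaugeSlot L M Rg (QuT L M o (siteT L M Rg)) (Q1 L M o) a')) t)
        (Real.sqrt (2 * B * (2 *
          Cpert (kappaBs o d a α β (a * (epsR o d α * (2 + epsR o d α) * Cst d a)) (kappa4F d a a' α β)) (2 * d * Cst d a) (CJ d a)
              (C2Bs o d L a α β C
                (a * C2gram (Cst d a) 1 (epsR o d α) (2 * d * Cst d a) (CJ d a) (Cst d a) (CdeltaR o d a α (theta0 d α (betaNE3 o C))))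
                (C4F o d L a a' α β C)) 0 t / (1 - (L : ℝ)⁻¹))))
        (δ / 2) (Real.sqrt ((L : ℝ)⁻¹)) :=
  balaban_final_decayStations_of_regular_rate L M a ha hd hreg hC le_rfl (invL_lt_one L hL) hNE3 ha' hαη hβη hη ht hdec

end Summit.QuantumFields.BalabanUV.T4Continuum.NE2BalabanDecayRateTheta

end
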